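import Mathlib
import HarnessLib

/-!
# Positive definite unimodular symmetric matrices over `ℝ[x]` are congruent to the identity

Topic `Literature/LinearAlgebra/QuadraticForm`. The special case of the Harder–Djoković theorem
on unimodular forms over `k[x]` (C. Hanselka, J. Algebra 487 (2017), **Thm. 1.2**: "any
unimodular bilinear form `β` on a free `k[x]`-module admits an orthogonal basis `q₁,…,qₙ` …
`β(qᵢ,qᵢ) ∈ kˣ`", citing D. Ž. Djoković, *Hermitian matrices over polynomial rings*, J. Algebra
43 (1976) 359–374, and W. Scharlau, *Quadratic and Hermitian Forms*) that is used in Hanselka's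
proof of the Helton–Vinnikov theorem (ibid. §5: "by Theorem 1.2 … we can orthogonalize it with
nonzero real numbers on the diagonal. These must be positive … This means `(I, β)` admits an
orthonormal basis"):

**Theorem** (`exists_isUnit_transpose_mul_mul_eq_one`). Let `G ∈ Mₙ(ℝ[x])` be such that
`G(a)` is positive definite for every real `a` and `det G` is a unit of `ℝ[x]` (a non-zero
constant). Then there is an invertible `P ∈ Mₙ(ℝ[x])` with `Pᵀ G P = 1`, i.e. the positive
definite unimodular `ℝ[x]`-lattice `(ℝ[x]ⁿ, G)` has an orthonormal basis.

## Proof (degree reduction; elementary and self-contained)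

Let `2dᵢ = deg Gᵢᵢ` (even, as `Gᵢᵢ > 0` on `ℝ`). Cauchy–Schwarz at every real point gives
`deg Gᵢⱼ ≤ dᵢ + dⱼ`, so the *leading form* `Ĝᵢⱼ := [x^{dᵢ+dⱼ}]Gᵢⱼ ∈ Mₙ(ℝ)` satisfies
`[x^{2Σdᵢ}] det G = det Ĝ`. If `det Ĝ ≠ 0` then, `det G` being constant, all `dᵢ = 0`: `G` is a
constant positive definite matrix, `G = RᵀR` with `R` invertible, `P = R⁻¹`. If `det Ĝ = 0`,
pick `c ≠ 0` with `Ĝc = 0` and `m` with `c_m ≠ 0` and `d_m` maximal among `{i | cᵢ ≠ 0}`;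
replacing the basis vector `e_m` by `Σᵢ cᵢ x^{d_m − dᵢ} eᵢ` (a unimodular change of basis)
replaces `G_{mm}` by a polynomial of degree `< 2d_m` (its `x^{2d_m}`-coefficient is `cᵀĜc = 0`)
and keeps the other diagonal entries, so `Σᵢ deg Gᵢᵢ` drops strictly; induct on it.

## References

* [Hanselka2017] C. Hanselka, Characteristic polynomials of symmetric matrices over the
  univariate polynomial ring, J. Algebra 487 (2017) 340–356: Thm. 1.2 (Harder/Djoković), §5.
* D. Ž. Djoković, Hermitian matrices over polynomial rings, J. Algebra 43 (1976) 359–374.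
-/

noncomputable section

open Polynomial Matrix Finset

namespace Literature.LinearAlgebra.QuadraticForm

/-! ### Real polynomials: degrees from pointwise inequalities -/

/-- A real polynomial of positive degree and positive leading coefficient takes a positive
value. [folklore] -/
theorem exists_eval_pos_of_leadingCoeff_pos {r : ℝ[X]} (hdeg : 0 < r.natDegree)
    (hlc : 0 < r.leadingCoeff) : ∃ a : ℝ, 0 < r.eval a := by
  have h := Polynomial.tendsto_atTop_of_leadingCoeff_nonneg r
    (natDegree_pos_iff_degree_pos.mp hdeg) hlc.le
  exact (h.eventually_gt_atTop 0).exists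

/-- **Cauchy–Schwarz degree bound.** If `p(a)² ≤ q(a)` for all real `a`, then
`2 deg p ≤ deg q`. [folklore] -/
theorem two_mul_natDegree_le_of_sq_le {p q : ℝ[X]} (h : ∀ a : ℝ, (p.eval a) ^ 2 ≤ q.eval a) :
    2 * p.natDegree ≤ q.natDegree := by
  by_contra hlt
  rw [not_le] at hlt
  have hpos : 0 < p.natDegree := by
    rcases Nat.eq_zero_or_pos p.natDegree with h0 | h0
    · rw [h0] at hlt
      exact absurd hlt (Nat.not_lt_zero _)
    · exact h0
  have hp0 : p ≠ 0 := by
    rintro rfl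
    rw [natDegree_zero] at hpos
    exact lt_irrefl _ hpos
  have hp2 : (p ^ 2).natDegree = 2 * p.natDegree := by rw [natDegree_pow]
  have hq : q.degree < (p ^ 2).degree := degree_lt_degree (by rw [hp2]; exact hlt)
  have hrdeg : (p ^ 2 - q).natDegree = 2 * p.natDegree := by
    rw [natDegree_sub_eq_left_of_natDegree_lt (by rw [hp2]; exact hlt), hp2]
  have hrlc : (p ^ 2 - q).leadingCoeff = p.leadingCoeff ^ 2 := by
    rw [leadingCoeff_sub_of_degree_lt hq, leadingCoeff_pow]
  have hlc0 : p.leadingCoeff ≠ 0 := leadingCoeff_ne_zero.mpr hp0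
  obtain ⟨a, ha⟩ := exists_eval_pos_of_leadingCoeff_pos (r := p ^ 2 - q) (by rw [hrdeg]; omega)
    (by rw [hrlc]; positivity)
  rw [eval_sub, eval_pow] at ha
  linarith [h a]

/-- A real polynomial of positive degree that is positive everywhere has positive leading
coefficient. [folklore] -/
theorem leadingCoeff_pos_of_forall_eval_pos {p : ℝ[X]} (h : ∀ a : ℝ, 0 < p.eval a)
    (hdeg : 0 < p.natDegree) : 0 < p.leadingCoeff := by
  by_contra hle
  rw [not_lt] at hle
  have hp0 : p ≠ 0 := by
    rintro rfl
    rw [natDegree_zero] at hdeg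
    exact lt_irrefl _ hdeg
  have hlc : 0 < (-p).leadingCoeff := by
    rw [leadingCoeff_neg]
    exact neg_pos.mpr (lt_of_le_of_ne hle (leadingCoeff_ne_zero.mpr hp0))
  obtain ⟨a, ha⟩ := exists_eval_pos_of_leadingCoeff_pos (r := -p) (by rwa [natDegree_neg]) hlc
  rw [eval_neg] at ha
  linarith [h a]

/-- A real polynomial that is positive everywhere has even degree. [folklore] -/
theorem even_natDegree_of_forall_eval_pos {p : ℝ[X]} (h : ∀ a : ℝ, 0 < p.eval a) :
    Even p.natDegree := by
  by_contra hodd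
  rw [Nat.not_even_iff_odd] at hodd
  have hdeg : 0 < p.natDegree := hodd.pos
  have h1 := leadingCoeff_pos_of_forall_eval_pos h hdeg
  have h' : ∀ a : ℝ, 0 < (p.comp (-X)).eval a := fun a => by
    rw [eval_comp, eval_neg, eval_X]
    exact h (-a)
  have hX : (-X : ℝ[X]).natDegree = 1 := by rw [natDegree_neg, natDegree_X]
  have hdeg' : (p.comp (-X)).natDegree = p.natDegree := by
    rw [natDegree_comp, hX, mul_one]
  have h2 := leadingCoeff_pos_of_forall_eval_pos h' (by rw [hdeg']; exact hdeg)
  rw [leadingCoeff_comp (by rw [hX]; exact one_ne_zero), leadingCoeff_neg, leadingCoeff_X,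
    hodd.neg_one_pow, mul_neg_one] at h2
  linarith

/-! ### Top coefficients of products and determinants with graded degree bounds -/

section TopCoeff

variable {R : Type*} [CommRing R]

/-- If `deg fᵢ ≤ dᵢ` then the coefficient of `X^{Σ dᵢ}` in `∏ fᵢ` is `∏ [X^{dᵢ}] fᵢ` (the version
of Mathlib's `Polynomial.coeff_prod_of_natDegree_le` with a degree bound depending on `i`).
[folklore] -/
theorem coeff_prod_of_natDegree_le_fun {ι : Type*} (s : Finset ι) (f : ι → R[X]) (d : ι → ℕ)
    (h : ∀ i ∈ s, (f i).natDegree ≤ d i) :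
    (∏ i ∈ s, f i).coeff (∑ i ∈ s, d i) = ∏ i ∈ s, (f i).coeff (d i) := by
  classical
  induction s using Finset.induction_on with
  | empty => simp
  | insert a s ha ih =>
    rw [Finset.prod_insert ha, Finset.sum_insert ha, Finset.prod_insert ha,
      coeff_mul_add_eq_of_natDegree_le (h a (Finset.mem_insert_self a s))
        ((natDegree_prod_le _ _).trans (Finset.sum_le_sum fun i hi =>
          h i (Finset.mem_insert_of_mem hi))),
      ih fun i hi => h i (Finset.mem_insert_of_mem hi)]

variable {n : Type*} [Fintype n] [DecidableEq n]

/-- **Top coefficient of a determinant with graded degree bounds.** If `deg Gᵢⱼ ≤ dᵢ + dⱼ`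
then `[X^{2Σdᵢ}] det G` is the determinant of the *leading form* `([X^{dᵢ+dⱼ}] Gᵢⱼ)ᵢⱼ`.
[folklore] -/
theorem coeff_det_of_natDegree_le_add (G : Matrix n n R[X]) (d : n → ℕ)
    (hG : ∀ i j, (G i j).natDegree ≤ d i + d j) :
    (det G).coeff (∑ i, d i + ∑ i, d i) =
      det (Matrix.of fun i j => (G i j).coeff (d i + d j)) := by
  rw [det_apply, det_apply, finsetSum_coeff]
  refine Finset.sum_congr rfl fun σ _ => ?_
  rw [coeff_smul]
  congr 1
  have hsum : ∑ i, d i + ∑ i, d i = ∑ i, (d (σ i) + d i) := by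
    rw [Finset.sum_add_distrib, Equiv.sum_comp σ d]
  rw [hsum, coeff_prod_of_natDegree_le_fun _ _ _ fun i _ => hG (σ i) i]
  simp only [Matrix.of_apply]

end TopCoeff

/-! ### Positive semidefinite real matrices: the `2 × 2` principal minors -/

/-- For a positive semidefinite real matrix, `Aᵢⱼ² ≤ Aᵢᵢ Aⱼⱼ`. [folklore] -/
theorem sq_apply_le_mul_apply_of_posSemidef {n : Type*} [Fintype n] [DecidableEq n]
    {A : Matrix n n ℝ} (hA : A.PosSemidef) (i j : n) : A i j ^ 2 ≤ A i i * A j j := by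
  rcases eq_or_ne i j with rfl | hij
  · rw [sq]
  have hsymm : A j i = A i j := by
    simpa using congr_fun (congr_fun hA.1 i) j
  have hq : ∀ t : ℝ, 0 ≤ A i i * (t * t) + 2 * A i j * t + A j j := by
    intro t
    have h := hA.dotProduct_mulVec_nonneg (Pi.single i t + Pi.single j 1)
    have hcalc : star (Pi.single i t + Pi.single j 1) ⬝ᵥ (A *ᵥ (Pi.single i t + Pi.single j 1))
        = A i i * (t * t) + 2 * A i j * t + A j j := by
      rw [star_trivial, mulVec_add, dotProduct_add, add_dotProduct, add_dotProduct,
        single_dotProduct, single_dotProduct, single_dotProduct, single_dotProduct,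
        mulVec_single, mulVec_single]
      simp only [Pi.smul_apply, Matrix.col_apply, MulOpposite.smul_eq_mul_unop,
        MulOpposite.unop_op, hsymm]
      ring
    rwa [hcalc] at h
  have hd := discrim_le_zero hq
  rw [discrim] at hd
  nlinarith [hd]

/-! ### Congruence bookkeeping -/

section Congruence

variable {R : Type*} [CommRing R] {n : Type*} [Fintype n] [DecidableEq n]

omit [DecidableEq n] in
/-- Entries of a congruence `AᵀGB`: `(AᵀGB)ᵢⱼ = A_{·i} ⬝ (G (B_{·j}))`. [folklore] -/
theorem transpose_mul_mul_apply (A G B : Matrix n n R) (i j : n) :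
    (Aᵀ * G * B) i j = (fun k => A k i) ⬝ᵥ (G *ᵥ fun l => B l j) := by
  simp only [Matrix.mul_apply, Matrix.transpose_apply, dotProduct, mulVec, Finset.mul_sum,
    Finset.sum_mul]
  rw [Finset.sum_comm]
  refine Finset.sum_congr rfl fun k _ => Finset.sum_congr rfl fun l _ => ?_
  ring

/-- The determinant of the identity matrix with one column replaced. [folklore] -/
theorem det_updateCol_one (m : n) (u : n → R) :
    ((1 : Matrix n n R).updateCol m u).det = u m := by
  rw [← cramer_apply, cramer_one]
  rfl

/-- Diagonal entries of `TᵀGT` away from the replaced column, `T = 1` with column `m`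
replaced. [folklore] -/
theorem congr_updateCol_apply_of_ne (G : Matrix n n R) (m : n) (u : n → R) {i : n} (hi : i ≠ m) :
    (((1 : Matrix n n R).updateCol m u)ᵀ * G * (1 : Matrix n n R).updateCol m u) i i = G i i := by
  rw [transpose_mul_mul_apply]
  have hcol : (fun k => ((1 : Matrix n n R).updateCol m u) k i) = Pi.single i 1 := by
    ext k
    rw [updateCol_apply, if_neg hi, Matrix.one_apply, Pi.single_apply]
  rw [hcol, mulVec_single_one, single_one_dotProduct, Matrix.col_apply]

/-- The replaced diagonal entry of `TᵀGT`: `uᵀ G u`. [folklore] -/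
theorem congr_updateCol_apply_self (G : Matrix n n R) (m : n) (u : n → R) :
    (((1 : Matrix n n R).updateCol m u)ᵀ * G * (1 : Matrix n n R).updateCol m u) m m =
      u ⬝ᵥ (G *ᵥ u) := by
  rw [transpose_mul_mul_apply]
  have hcol : (fun k => ((1 : Matrix n n R).updateCol m u) k m) = u := by
    ext k
    rw [updateCol_apply, if_pos rfl]
  rw [hcol]

end Congruence

/-! ### Evaluation of polynomial matrices -/

section Eval

variable {n : Type*} [Fintype n] [DecidableEq n]

/-- `(M N).map (eval a) = M(a) N(a)`. [folklore] -/
theorem map_eval_mul (M N : Matrix n n ℝ[X]) (a : ℝ) :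
    (M * N).map (Polynomial.eval a) = M.map (Polynomial.eval a) * N.map (Polynomial.eval a) := by
  rw [← coe_evalRingHom, ← RingHom.mapMatrix_apply, ← RingHom.mapMatrix_apply,
    ← RingHom.mapMatrix_apply, map_mul]

omit [Fintype n] [DecidableEq n] in
/-- A polynomial matrix whose values at all real points are Hermitian is symmetric.
[folklore] -/
theorem isSymm_of_forall_isHermitian (G : Matrix n n ℝ[X])
    (hG : ∀ a : ℝ, (G.map (Polynomial.eval a)).IsHermitian) : G.IsSymm := by
  refine Matrix.IsSymm.ext fun i j => ?_
  apply Polynomial.funext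
  intro a
  have h := congr_fun (congr_fun (hG a) i) j
  simpa [Matrix.conjTranspose_apply, Matrix.map_apply] using h

end Eval

/-! ### The degree-reduction step -/

section Step

variable {n : Type*} [Fintype n] [DecidableEq n]

omit [DecidableEq n] in
/-- Degree and top coefficient of `uᵀGu` for the reduction vector `uᵢ = cᵢ x^{D − dᵢ}`: if
`deg Gᵢⱼ ≤ dᵢ + dⱼ` and `dᵢ ≤ D` whenever `cᵢ ≠ 0`, then `deg uᵀGu ≤ 2D` and
`[x^{2D}] uᵀGu = cᵀ Ĝ c` with `Ĝᵢⱼ = [x^{dᵢ+dⱼ}] Gᵢⱼ`. [folklore] -/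
theorem natDegree_le_and_coeff_reduction (G : Matrix n n ℝ[X]) (d : n → ℕ)
    (hG : ∀ i j, (G i j).natDegree ≤ d i + d j) (c : n → ℝ) (D : ℕ)
    (hD : ∀ i, c i ≠ 0 → d i ≤ D) :
    let u : n → ℝ[X] := fun i => C (c i) * X ^ (D - d i)
    (u ⬝ᵥ (G *ᵥ u)).natDegree ≤ 2 * D ∧
      (u ⬝ᵥ (G *ᵥ u)).coeff (2 * D) =
        c ⬝ᵥ ((Matrix.of fun i j => (G i j).coeff (d i + d j)) *ᵥ c) := by
  intro u
  -- termwise statement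
  have hterm : ∀ i j, (u i * (G i j * u j)).natDegree ≤ 2 * D ∧
      (u i * (G i j * u j)).coeff (2 * D) = c i * ((G i j).coeff (d i + d j) * c j) := by
    intro i j
    by_cases hi : c i = 0
    · simp [u, hi]
    by_cases hj : c j = 0
    · simp [u, hj]
    have hdi := hD i hi
    have hdj := hD j hj
    have hrw : u i * (G i j * u j) = C (c i * c j) * (X ^ (D - d i + (D - d j)) * G i j) := by
      simp only [u, map_mul, pow_add]
      ring
    rw [hrw]
    constructor
    · refine (natDegree_C_mul_le _ _).trans ((natDegree_mul_le).trans ?_)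
      rw [natDegree_pow, natDegree_X, mul_one]  -- may need natDegree_X_pow
      have := hG i j
      omega
    · rw [coeff_C_mul, coeff_X_pow_mul', if_pos (by omega)]
      have h2 : 2 * D - (D - d i + (D - d j)) = d i + d j := by omega
      rw [h2]
      ring
  have hexp : u ⬝ᵥ (G *ᵥ u) = ∑ i, ∑ j, u i * (G i j * u j) := by
    simp only [dotProduct, mulVec, Finset.mul_sum]
  rw [hexp]
  constructor
  · refine natDegree_sum_le_of_forall_le _ _ fun i _ => ?_
    exact natDegree_sum_le_of_forall_le _ _ fun j _ => (hterm i j).1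
  · rw [finsetSum_coeff]
    simp only [finsetSum_coeff, (hterm _ _).2, dotProduct, mulVec, Matrix.of_apply,
      Finset.mul_sum]

end Step

/-! ### The theorem -/

section Main

open scoped MatrixOrder ComplexOrder

variable {n : Type*} [Fintype n] [DecidableEq n]

/-- **Constant case.** A positive definite real matrix `G₀` is `RᵀR` with `R` invertible, so
`Pᵀ G₀ P = 1` for `P = R⁻¹`; stated for the constant polynomial matrix `G₀.map C`.
[folklore] -/
theorem exists_isUnit_transpose_mul_mul_eq_one_of_const (G₀ : Matrix n n ℝ) (hG₀ : G₀.PosDef) :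
    ∃ P : Matrix n n ℝ[X], IsUnit P ∧ Pᵀ * G₀.map C * P = 1 := by
  obtain ⟨y, hy, hfac⟩ :=
    CStarAlgebra.isStrictlyPositive_iff_eq_star_mul_self.mp hG₀.isStrictlyPositive
  -- `G₀ = yᵀ y`; take `P = y⁻¹`
  obtain ⟨yu, rfl⟩ := hy
  set φ : Matrix n n ℝ →+* Matrix n n ℝ[X] := (C : ℝ →+* ℝ[X]).mapMatrix with hφ
  have hφapp : ∀ M : Matrix n n ℝ, M.map C = φ M := fun M => rfl
  have hφT : ∀ M : Matrix n n ℝ, (φ M)ᵀ = φ Mᵀ := fun M => by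
    rw [hφ, RingHom.mapMatrix_apply, RingHom.mapMatrix_apply, transpose_map]
  refine ⟨φ ((yu⁻¹ : (Matrix n n ℝ)ˣ) : Matrix n n ℝ), (Units.map φ.toMonoidHom yu⁻¹).isUnit, ?_⟩
  have hstar : star (yu : Matrix n n ℝ) = (yu : Matrix n n ℝ)ᵀ := by
    rw [star_eq_conjTranspose, conjTranspose_eq_transpose_of_trivial]
  have h1 : ((yu⁻¹ : (Matrix n n ℝ)ˣ) : Matrix n n ℝ)ᵀ * ((yu : Matrix n n ℝ)ᵀ * yu) *
      ((yu⁻¹ : (Matrix n n ℝ)ˣ) : Matrix n n ℝ) = 1 := by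
    rw [← Matrix.mul_assoc, ← Matrix.transpose_mul, Units.mul_inv, Matrix.transpose_one,
      Matrix.one_mul, Units.mul_inv]
  rw [hφapp, hφT, hfac, hstar, ← map_mul, ← map_mul, h1, map_one]

/-- **Positive definite unimodular symmetric matrices over `ℝ[x]` are congruent to `1`** (the
positive definite case of [Hanselka2017, Thm. 1.2] = Harder–Djoković; the form in which it enters
the proof of Hanselka's Theorem 1 and of the Helton–Vinnikov theorem, ibid. §5). If
`G ∈ Mₙ(ℝ[x])` is positive definite at every real point and `det G` is a unit, then
`Pᵀ G P = 1` for some invertible `P ∈ Mₙ(ℝ[x])`.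
[cite: Hanselka2017, Thm. 1.2 (positive definite case over ℝ[x]) and §5] -/
theorem exists_isUnit_transpose_mul_mul_eq_one (G : Matrix n n ℝ[X])
    (hG : ∀ a : ℝ, (G.map (Polynomial.eval a)).PosDef) (hdet : IsUnit G.det) :
    ∃ P : Matrix n n ℝ[X], IsUnit P ∧ Pᵀ * G * P = 1 := by
  -- strong induction on `N = Σᵢ deg Gᵢᵢ`
  suffices key : ∀ (N : ℕ) (G : Matrix n n ℝ[X]), ∑ i, (G i i).natDegree = N →
      (∀ a : ℝ, (G.map (Polynomial.eval a)).PosDef) → IsUnit G.det →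
      ∃ P : Matrix n n ℝ[X], IsUnit P ∧ Pᵀ * G * P = 1 from key _ G rfl hG hdet
  intro N
  induction N using Nat.strong_induction_on with
  | _ N ih =>
  intro G hN hG hdet
  have hsymm : G.IsSymm := isSymm_of_forall_isHermitian G fun a => (hG a).isHermitian
  have hsymm' : ∀ i j, G j i = G i j := fun i j => by
    simpa using congr_fun (congr_fun hsymm i) j
  -- diagonal entries are positive everywhere, hence of even degree `2 dᵢ`
  have hdiag : ∀ i (a : ℝ), 0 < (G i i).eval a := fun i a => by
    simpa [Matrix.map_apply] using (hG a).diag_pos (i := i)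
  have heven : ∀ i, Even (G i i).natDegree := fun i =>
    even_natDegree_of_forall_eval_pos (hdiag i)
  choose d hd using heven
  have hd2 : ∀ i, (G i i).natDegree = 2 * d i := fun i => by rw [hd i]; ring
  -- Cauchy–Schwarz: `deg Gᵢⱼ ≤ dᵢ + dⱼ`
  have hCS : ∀ i j, (G i j).natDegree ≤ d i + d j := by
    intro i j
    have h2 : 2 * (G i j).natDegree ≤ (G i i * G j j).natDegree := by
      apply two_mul_natDegree_le_of_sq_le
      intro a
      rw [eval_mul]
      have := sq_apply_le_mul_apply_of_posSemidef (hG a).posSemidef i j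
      simpa [Matrix.map_apply] using this
    have h3 : (G i i * G j j).natDegree ≤ 2 * d i + 2 * d j :=
      natDegree_mul_le.trans (by rw [hd2, hd2])
    omega
  -- the leading form
  set Ĝ : Matrix n n ℝ := Matrix.of fun i j => (G i j).coeff (d i + d j) with hĜ
  by_cases hcase : Ĝ.det = 0
  · -- reduction step
    obtain ⟨c, hc0, hc⟩ := Matrix.exists_mulVec_eq_zero_iff.mpr hcase
    -- an index `m` with `c m ≠ 0` and `d m` maximal among those
    have hS : (Finset.univ.filter fun i => c i ≠ 0).Nonempty := by
      by_contra hemp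
      rw [Finset.not_nonempty_iff_eq_empty, Finset.filter_eq_empty_iff] at hemp
      apply hc0
      ext i
      simpa using hemp (Finset.mem_univ i)
    obtain ⟨m, hmS, hmax⟩ := Finset.exists_max_image _ d hS
    have hcm : c m ≠ 0 := (Finset.mem_filter.mp hmS).2
    have hDm : ∀ i, c i ≠ 0 → d i ≤ d m := fun i hi =>
      hmax i (Finset.mem_filter.mpr ⟨Finset.mem_univ _, hi⟩)
    -- the reduction vector and the elementary matrix
    set u : n → ℝ[X] := fun i => C (c i) * X ^ (d m - d i) with hu
    set T : Matrix n n ℝ[X] := (1 : Matrix n n ℝ[X]).updateCol m u with hT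
    have hum : u m = C (c m) := by simp [hu]
    have hdetT : T.det = C (c m) := by rw [hT, det_updateCol_one, hum]
    have hTunit : IsUnit T := by
      rw [isUnit_iff_isUnit_det, hdetT]
      exact isUnit_C.mpr (IsUnit.mk0 _ hcm)
    set G' : Matrix n n ℝ[X] := Tᵀ * G * T with hG'
    -- `G'` is again positive definite everywhere with unit determinant
    have hG'pd : ∀ a : ℝ, (G'.map (Polynomial.eval a)).PosDef := by
      intro a
      have hTa : IsUnit (T.map (Polynomial.eval a)) := by
        rw [isUnit_iff_isUnit_det, ← coe_evalRingHom, ← RingHom.mapMatrix_apply,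
          ← RingHom.map_det, hdetT]
        simp [hcm]
      rw [hG', map_eval_mul, map_eval_mul, transpose_map,
        ← conjTranspose_eq_transpose_of_trivial]
      exact (hG a).conjTranspose_mul_mul_same (mulVec_injective_iff_isUnit.mpr hTa)
    have hG'det : IsUnit G'.det := by
      rw [hG', det_mul, det_mul, det_transpose]
      exact ((isUnit_iff_isUnit_det _).mp hTunit).mul hdet |>.mul
        ((isUnit_iff_isUnit_det _).mp hTunit)
    -- the diagonal degrees
    have hdiag' : ∀ i, i ≠ m → G' i i = G i i := fun i hi => by
      rw [hG', hT, congr_updateCol_apply_of_ne G m u hi]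
    have hmm : G' m m = u ⬝ᵥ (G *ᵥ u) := by
      rw [hG', hT, congr_updateCol_apply_self]
    obtain ⟨hdeg_le, hcoeff⟩ := natDegree_le_and_coeff_reduction G d hCS c (d m) hDm
    have hcoeff0 : (u ⬝ᵥ (G *ᵥ u)).coeff (2 * d m) = 0 := by
      rw [hcoeff, ← hĜ, hc, dotProduct_zero]
    have hne : G' m m ≠ 0 := by
      intro h0
      have := (hG'pd 0).diag_pos (i := m)
      simp [Matrix.map_apply, h0] at this
    have hlt : (G' m m).natDegree < (G m m).natDegree := by
      rw [hd2 m, hmm]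
      rcases (hdeg_le).lt_or_eq with hlt | heq
      · exact hlt
      · exfalso
        apply hne
        rw [hmm]
        apply leadingCoeff_eq_zero.mp
        rw [leadingCoeff, heq, hcoeff0]
    have hsum : ∑ i, (G' i i).natDegree < N := by
      rw [← hN, ← Finset.add_sum_erase _ _ (Finset.mem_univ m),
        ← Finset.add_sum_erase _ _ (Finset.mem_univ m)]
      refine add_lt_add_of_lt_of_le hlt (Finset.sum_le_sum fun i hi => ?_)
      rw [hdiag' i (Finset.ne_of_mem_erase hi)]
    -- induction hypothesis
    obtain ⟨P', hP'unit, hP'⟩ := ih _ hsum G' rfl hG'pd hG'det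
    refine ⟨T * P', hTunit.mul hP'unit, ?_⟩
    rw [transpose_mul, Matrix.mul_assoc, Matrix.mul_assoc, ← Matrix.mul_assoc G,
      ← Matrix.mul_assoc Tᵀ, ← Matrix.mul_assoc Tᵀ, ← hG', ← Matrix.mul_assoc, hP']
  · -- constant case: `det Ĝ ≠ 0` forces all `dᵢ = 0`
    have htop : (det G).coeff (∑ i, d i + ∑ i, d i) = Ĝ.det := by
      rw [hĜ]
      exact coeff_det_of_natDegree_le_add G d hCS
    have hdeg0 : (det G).natDegree = 0 := natDegree_eq_zero_of_isUnit hdet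
    have hsum0 : ∑ i, d i = 0 := by
      by_contra hne
      have hlt : (det G).natDegree < ∑ i, d i + ∑ i, d i := by omega
      rw [coeff_eq_zero_of_natDegree_lt hlt] at htop
      exact hcase htop.symm
    have hd0 : ∀ i, d i = 0 := fun i => by
      have := Finset.sum_eq_zero_iff.mp hsum0 i (Finset.mem_univ i)
      exact this
    have hconst : ∀ i j, (G i j).natDegree = 0 := fun i j => by
      have := hCS i j
      rw [hd0, hd0] at this
      omega
    -- `G = G₀.map C` with `G₀ = G(0)`
    set G₀ : Matrix n n ℝ := G.map (Polynomial.eval 0) with hG₀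
    have hGG₀ : G = G₀.map C := by
      refine Matrix.ext fun i j => ?_
      rw [Matrix.map_apply, hG₀, Matrix.map_apply, ← coeff_zero_eq_eval_zero]
      exact eq_C_of_natDegree_eq_zero (hconst i j)
    obtain ⟨P, hP, hP1⟩ := exists_isUnit_transpose_mul_mul_eq_one_of_const G₀ (hG 0)
    exact ⟨P, hP, by rw [hGG₀]; exact hP1⟩

/-- **Corollary (positive semidefinite formulation).** If `G ∈ Mₙ(ℝ[x])` is positive
SEMIdefinite at every real point and `det G` is a unit, then `G` is positive definite at every
real point, and `Pᵀ G P = 1` for some invertible `P`. This is the form used for scaled trace forms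
`Tr(c·ab)` with `c` a sum of squares in [Hanselka2017, §5]. [cite: Hanselka2017, Thm. 1.2 and §5] -/
theorem exists_isUnit_transpose_mul_mul_eq_one_of_posSemidef (G : Matrix n n ℝ[X])
    (hG : ∀ a : ℝ, (G.map (Polynomial.eval a)).PosSemidef) (hdet : IsUnit G.det) :
    ∃ P : Matrix n n ℝ[X], IsUnit P ∧ Pᵀ * G * P = 1 := by
  refine exists_isUnit_transpose_mul_mul_eq_one G (fun a => ?_) hdet
  refine (hG a).posDef_iff_det_ne_zero.mpr ?_
  have hdetmap : (G.map (Polynomial.eval a)).det = G.det.eval a := by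
    rw [← coe_evalRingHom, ← RingHom.mapMatrix_apply, ← RingHom.map_det]
  obtain ⟨r, hr, hrdet⟩ := Polynomial.isUnit_iff.mp hdet
  rw [hdetmap, ← hrdet, eval_C]
  exact hr.ne_zero

end Main

end Literature.LinearAlgebra.QuadraticForm
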